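import Literature.MathematicalPhysics.QuantumFieldTheory.BalabanImbrieJaffe1984to88.BIJ88RootedUrsell310

/-!
# `BalabanImbrieJaffe1984to88.BIJ88ConnectedGraphResummation` — T. Bałaban, J. Imbrie, A. Jaffe, *Effective action and cluster
properties of the abelian Higgs model*, Commun. Math. Phys. **114** (1988) 257–315 [BalabanImbrieJaffe1988]: Sect. 5.14, pp. 309–310 —
the CONNECTED-GRAPH RESUMMATION SCHEME (*"a scheme familiar to one in [10]"*) DERIVED: from the cluster expansion (5.14.3) of the
un-normalized expectations (prime-dropped form, p. 309) to the first display of p. 310 (*"This enables us to factor out the normalization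
z_t"*), the second (*"The connected components of G define a partition of H which corresponds to the partition in the formula"*) and the
third (*"G_c runs over connected graphs involving all clusters"*) — the formula that the gen-5 file `BIJ88W6PrimeBound` took as the MODEL
of `W₆^{(k)′}`

HONEST FRAMING (cell `lit-balaban`, verbatim): statement-level skeleton of published theorems with citation tags; proofs where landed; nothing here is a claim about the Yang–Mills mass gap.

PDF held: `paper:balaban1988-cmp114-bij-abelian-higgs-effective-action` (journal page = PDF page + 256); pp. 309–310 = PDF pp. 53–54 read
this session as images (x2 renders `original-p053-x2.png`, `original-p054-x2.png`, seat folder `renders/`).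

CITATION HEADER (verbatim).  p. 309 [PDF 53]: *"⟨Π_{j∈H}(d/dt)_{γ_j} χ′_{Λ₁₂,t} e^{−tṼ^{(k)}(Λ₁₂)}⟩_{1,Λ₁₂} = Σ_{{X_β} filling Λ₁₂} Π_β
g₃(H_β,X_β). (5.14.3) Here H_β ⊂ H specifies which (d/dt)_{γ_j} have supports intersecting X_β. … If |X_β| = 1, H_β = ∅, we write
g₃(∅,X_β) = 1 + g′₃(∅,X_β) and the above expansion holds again, but without the condition that {X_β} fill Λ₁₂. The {X_β} must cover all
cubes connected with the (d/dt)_{γ_j}, j ∈ H. Let us drop the prime … Returning to our expansion, let us sum first over {H_γ}, the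
partition of H determined by the {X_β}. Denote the X_β's with H_β ≠ ∅ by X_γ; the X_β with H_β = ∅ by Y_δ. The expansion (5.14.2)
becomes Σ_{{H_γ}∈𝒫(H)} Σ_{{X_γ},{Y_δ} nonoverlapping} Π_γ g₃(H_γ,X_γ) Π_δ g₃(∅,Y_δ). Each X_γ must cover and connect all the
t-derivatives specified by H_γ. Next we reorganize this expansion in order to extract the truncated expectation values (5.14.2). This
involves adding and subtracting terms in a scheme familiar to one in [10]. We insert factors u(X,Y) = 0 if X, Y overlap, 1 if X, Y do not
overlap,"*  p. 310 [PDF 54]: *"and similarly factors u(X₁,X₂), u(Y₁,Y₂). We extend the sums over {X_γ}, {Y_δ} to nonoverlapping sets;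
however the corresponding subsets of H remain the same – no duplication of t-derivatives. We put u = 1 + a and expand in the usual
manner. This enables us to factor out the normalization z_t(Λ₁₂^{(k)}) to obtain ⟨Π_{j∈H}(d/dt)_{γ_j}⟩_t = Σ_{{H_γ}∈𝒫(H)} Σ_{{X_γ}}
Σ_{(Y₁,…,Y_B)} (1/B!) Σ_G Π_{ℒ∈G} a(ℒ) Π_γ g₃(H_γ,X_γ) Π_{δ=1}^B g₃(∅,Y_δ). Here ℒ denotes pairs of clusters (lines) and G runs over
graphs of such lines in which each Y_δ is connected directly or indirectly to some X_γ. The connected components of G define a partition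
of H which corresponds to the partition in the formula ⟨Π_{j∈H}(d/dt)_{γ_j}⟩_t = Σ_{{H′_τ}∈𝒫(H)} Π_τ ⟨Π_{j∈H′_τ}[;(d/dt)_{γ_j}]⟩_t. Thus we
have a formula ⟨Π_{j∈H}[;(d/dt)_{γ_j}]⟩_t = Σ_{{H_γ}∈𝒫(H)} Σ_{{X_γ}} Σ_{(Y₁,…,Y_B)} (1/B!) Σ_{G_c} Π_{ℒ∈G_c} a(ℒ) Π_γ g₃(H_γ,X_γ)
Π_{δ=1}^B g₃(∅,Y_δ), where G_c runs over connected graphs involving all clusters X_γ, Y_δ, and hence all of H."*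

WHAT IS REPRODUCED (unit `lit-balaban-p25`, generation 6 of the Phase-2 proof seat p25; SKELETON row `C2.Claim@310`, first clause, of
`HOME/lit-balaban-r16/ROWS-C2-part2.md`; HOME `run/shared/lean/pub/lit-balaban/lit-balaban-p25/`).  The three displays of p. 310, PROVED
as identities of the hard-core polymer algebra, for an ARBITRARY finite cube set `V`, slot set `S` (the derivative slots `j ∈ H`, `H ⊆ S`
finite sets `K`), polymer family `Q : Finset (Finset V)` (the connected unions of cubes), localization `loc : S → V` (the cube of
`(d/dt)_{γ_j}`) and activity `w : Finset S → Finset V → ℝ` (`w K Y = g₃(H_β = K, X_β = Y)` at fixed `t`, `γ`):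
§1 THE OBJECTS in ORDERED form (READING (a)): a labelled family with `ι`-indexed cluster slots is a pair `(H_i, Z_i)_{i∈ι}` with
  `(H_i)` an ordered weak partition of `K` (`OWP`: *"the corresponding subsets of H … no duplication of t-derivatives"*; the slots with
  `H_i ≠ ∅` are the `X_γ` — `marked` — the others the `Y_δ`), `Z_i ∈ Q`, and the cover condition `loc(H_i) ⊆ Z_i` (`Cov`); `Nraw ι K` =
  the expansion of p. 309 (last display) with the hard core `𝟙[Z pairwise disjoint]` (`BIJ88RootedUrsell310.hardCore`) as a factor;
  `Draw ι K` = the right side of display 1 with the ROOTED graph coefficient `rhoX Z univ (marked)` (= the printed *"Σ_G Π a(ℒ), each Y_δ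
  connected to some X_γ"*, `BIJ88RootedUrsell310.rhoX_eq_sum_graphs`); `Traw ι K` = the right side of display 3 with `ρ^T(Z)` (= the
  printed *"Σ_{G_c} Π a(ℒ)"*, `UrsellTreeGraphBound.rhoT_eq_sum_graphs`); `Nord/Dord/Tord m K` = the same over `ι = Fin m` weighted `1/m!`;
  `Nsum/Dsum/Tsum K` = the series over `m`.
§2–§4 THE SPLITTING ENGINE: gluing the slots of `A ⊆ ι` and of its complement (`glue`, `sum_glue`), the labelling constraint splits
  (`owp_glue_iff`), whence `split_core`; relabelling invariance (`Nraw_congr`, `Draw_congr`, `Traw_congr`); restriction of `ρ^T`, `ρX`,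
  the hard core and the activity product to a group of slots.
§5 DISPLAY 1 RAW (`Nraw_eq_sum_Draw_mul`): by the ROOTED SUNSET identity of the companion file (*"put u = 1 + a and expand"*),
  `Nraw ι K = Σ_{A ⊆ ι} Draw ↥A K · Nraw ↥Aᶜ ∅` — the components of the graph hanging on the roots against the rest, which is the
  normalization; §7 with `ι = Fin m` and the `1/m!` (`C(m,a)·a!·(m−a)! = m!`): `Nord m K = Σ_{a+c=m} Dord a K · Nord c ∅` (`Nord_conv`),
  and §8 summed by the Cauchy product (`Nsum_eq_mul_Dsum`: `N(K) = N(∅)·D(K)`, `moment_eq_Dsum`: `N(K)/z = D(K)` for `z = N(∅) ≠ 0`).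
§6 THE ROOTED RECURSION (`Draw_eq_sum_Traw_mul`, `Dord_rooted`, `Dsum_rooted`): splitting off the block of the partition containing the
  cluster of a fixed root `j₀ ∈ K` (`BIJ88RootedUrsell310.rhoX_eq_sum_block`): `D(K) = Σ_{j₀∈b⊆K} T(b)·D(K∖b)`.
§8 DISPLAY 2 (`Dsum_eq_sum_setPartitions`): `D(K) = Σ_{π ∈ 𝒫(K)} Π_{b∈π} T(b)` (*"The connected components of G define a partition of H"*),
  by induction from the rooted recursion; DISPLAY 3 (`truncated_eq_Tsum`, `display3`): the truncated functions are DEFINED by display 2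
  (the moment–cumulant relation over set partitions, which determines them by Möbius inversion: strong induction on `K`), hence any `κ` with
  `N(K)/z = Σ_{π∈𝒫(K)} Π_{b∈π} κ(b)` for all nonempty `K ⊆ H` satisfies `κ(H) = T(H)` = the connected-graph series.
HYPOTHESES, all explicit: `∅ ∉ Q` (polymers are nonempty, so a hard-core family has at most `|Q|` clusters and the normalization is a
finite sum, `Nord_empty_eq_zero`); absolute convergence of the connected series `Σ_m |Tord m b|` for the nonempty `b ⊆ H` (the paper's
*"standard exercise"* smallness regime; discharged for the W₆′ model in `BIJ88W6PrimeBound` under (5.14.4)); `z ≠ 0` where a quotient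
is printed.  The degree-wise identities (`Nord_conv`, `Dord_rooted`) are hypothesis-free finite algebra.
READINGS (declared).  (a) ORDERED RE-INDEXING (as in gen 5, READING (iv) of `BIJ88W6PrimeBound`, there proved equivalent to the printed
partition form: `term_eq_sum_pterm`): a set partition `{H_γ}` of `K` with `p` blocks, its clusters `X_γ` and an ordered tuple
`(Y₁,…,Y_B)` correspond to `m!/B!` labelled `m`-families `(H_i,Z_i)_{i<m}`, `m = p + B` (an injection of the blocks into the slots, the
`Y_δ` in the remaining slots in order), each weighted `1/m!` here — total weight `1/B!` as printed; the unordered nonoverlapping families of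
p. 309 with `m` clusters are counted `m!` times in `Nraw (Fin m)`.  (b) (5.14.3) in its prime-dropped form (p. 309: *"the above expansion
holds again, but without the condition that {X_β} fill Λ₁₂ … Let us drop the prime"*) is the INPUT: `N(K)` is DEFINED as that expansion
of the un-normalized expectation `⟨Π_{j∈K}(d/dt)_{γ_j} χ′ e^{−tṼ}⟩_{1,Λ₁₂}` in the activities `g₃`; the normalized expectation of display
1 is `N(K)/N(∅)`, `N(∅) = z_t(Λ₁₂)`.  (c) The truncated expectations `⟨…[;…]⟩_t` are characterized by display 2 on all sub-collections
(the standard inductive definition); display 3 is then a theorem (`display3`).  (d) `t`, `γ` and the regions are parameters of `w`, `Q`,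
`loc`; the identities hold pointwise in them.  The link `ℛ_k(Λ₁₂) = Σ_X W₆′(X)` with gen 5's `W6'` is the sibling file (3/3).
All statements are finite identities or identities of absolutely convergent real series; 0 `sorry`, 0 new `Prop` facts; nothing of the
paper beyond the cited sentences is asserted.  Engine credits: the tree's `HardCoreUrsell` (set partitions, Möbius-defined `hcUrsell`),
[Dimock2013] App. B (`UrsellTreeGraphBound`, `UrsellConnectedGraphSum`), Mathlib's Cauchy-product lemmas.
-/

open Finset
open Literature.Probability.LatticeModels (IsSetPartition setPartitions mem_setPartitions setPartitions_empty
  isSetPartition_singleton sum_setPartitions_eq_sum_block)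
open Literature.MathematicalPhysics.QuantumFieldTheory.Dimock2011to13.UrsellTreeGraphBound (rhoT overlapGraph)
open Literature.MathematicalPhysics.QuantumFieldTheory.BalabanImbrieJaffe1984to88.BIJ88RootedUrsell310 (rhoX hardCore rooted_sunset
  rhoX_eq_sum_block rhoX_root_inter rhoX_root_empty rhoX_empty rhoX_map rhoT_map hardCore_empty)

noncomputable section

namespace Literature.MathematicalPhysics.QuantumFieldTheory.BalabanImbrieJaffe1984to88.BIJ88ConnectedGraphResummation

variable {V : Type*} {S : Type*}

/-! ## §1 The ordered cluster sums (p. 309 last display, p. 310 displays 1 and 3) -/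

section Defs

variable {ι : Type*}

/-- every cluster is a polymer of the family `Q` (*"X's are arbitrary connected unions of r(e_k)-cubes"*, p. 289).
[cite: BalabanImbrieJaffe1988, p.310 (Sect. 5.14)] -/
def InQ (Q : Finset (Finset V)) (Z : ι → Finset V) : Prop := ∀ i, Z i ∈ Q

/-- the covering condition: *"Each X_γ must cover … all the t-derivatives specified by H_γ"* (p. 309) — the cube `loc j` of the
derivative slot `j ∈ H_i` lies in the cluster `Z_i`. [cite: BalabanImbrieJaffe1988, p.309 (Sect. 5.14)] -/
def Cov (loc : S → V) (Hs : ι → Finset S) (Z : ι → Finset V) : Prop := ∀ i, ∀ j ∈ Hs i, loc j ∈ Z i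

/-- the activity product `Π_γ g₃(H_γ, X_γ) Π_δ g₃(∅, Y_δ)` of an ordered labelled family. [cite: BalabanImbrieJaffe1988, p.310 (Sect. 5.14)] -/
def wprod [Fintype ι] (w : Finset S → Finset V → ℝ) (Hs : ι → Finset S) (Z : ι → Finset V) : ℝ := ∏ i, w (Hs i) (Z i)

/-- the ROOTS: the slots of the labelled clusters `X_γ` (`H_γ ≠ ∅`); the others are the `Y_δ` (*"Denote the X_β's with H_β ≠ ∅ by
X_γ; the X_β with H_β = ∅ by Y_δ"*, p. 309). [cite: BalabanImbrieJaffe1988, p.309 (Sect. 5.14)] -/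
def marked [Fintype ι] (Hs : ι → Finset S) : Finset ι := univ.filter fun i => (Hs i).Nonempty

/-- An ORDERED WEAK PARTITION of the slot set `K` indexed by the cluster slots: the blocks `H_i ⊆ K` (*"the corresponding subsets
of H"*, `H_γ` for a labelled cluster `X_γ`, `∅` for a `Y_δ`), pairwise disjoint with union `K` (*"no duplication of
t-derivatives"*). [cite: BalabanImbrieJaffe1988, p.310 (Sect. 5.14)] -/
def OWP [Fintype ι] [DecidableEq S] (K : Finset S) (Hs : ι → Finset S) : Prop :=
  (∀ i i', i ≠ i' → Disjoint (Hs i) (Hs i')) ∧ univ.biUnion Hs = K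

/-- decidability of the ordered-weak-partition predicate (non-Prop plumbing). [folklore] -/
instance instDecOWP [Fintype ι] [DecidableEq ι] [DecidableEq S] (K : Finset S) (Hs : ι → Finset S) :
    Decidable (OWP K Hs) := by
  unfold OWP; infer_instance

/-- decidability of the polymer-membership predicate (non-Prop plumbing). [folklore] -/
instance instDecInQ [Fintype ι] [DecidableEq V] (Q : Finset (Finset V)) (Z : ι → Finset V) : Decidable (InQ Q Z) := by
  unfold InQ; infer_instance

/-- decidability of the covering predicate (non-Prop plumbing). [folklore] -/
instance instDecCov [Fintype ι] [DecidableEq V] (loc : S → V) (Hs : ι → Finset S) (Z : ι → Finset V) :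
    Decidable (Cov loc Hs Z) := by
  unfold Cov; infer_instance

variable [DecidableEq V] [Fintype V] [DecidableEq S] [Fintype S] (Q : Finset (Finset V)) (loc : S → V)
  (w : Finset S → Finset V → ℝ)

/-- **The un-normalized expectation expanded** (p. 309, last display: *"Σ_{{H_γ}∈𝒫(H)} Σ_{{X_γ},{Y_δ} nonoverlapping} Π_γ g₃(H_γ,X_γ)
Π_δ g₃(∅,Y_δ)"* — the prime-dropped form of (5.14.3): *"the above expansion holds again, but without the condition that {X_β} fill
Λ₁₂. The {X_β} must cover all cubes connected with the (d/dt)_{γ_j}, j ∈ H"*), in ORDERED form over `ι`-indexed families (the raw sum,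
to be weighted `1/|ι|!`): `Σ_{(H_i, Z_i)_i} [OWP K][Z_i ∈ Q][cover] · 𝟙[the Z_i pairwise disjoint] · Π_i w(H_i, Z_i)`.
[cite: BalabanImbrieJaffe1988, p.309 (Sect. 5.14)] -/
def Nraw (ι : Type*) [Fintype ι] [DecidableEq ι] (K : Finset S) : ℝ :=
  ∑ Hs : ι → Finset S, ∑ Z : ι → Finset V,
    if OWP K Hs ∧ InQ Q Z ∧ Cov loc Hs Z then (hardCore Z univ : ℝ) * wprod w Hs Z else 0

/-- **The right side of the first display of p. 310** in ORDERED raw form: `Σ_{(H_i, Z_i)_i} [OWP K][Z_i ∈ Q][cover] ·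
ρX(Z; roots = the labelled slots) · Π_i w(H_i, Z_i)`, `ρX` = the printed *"Σ_G Π_{ℒ∈G} a(ℒ), G runs over graphs of lines in which
each Y_δ is connected directly or indirectly to some X_γ"* (`BIJ88RootedUrsell310.rhoX`, `rhoX_eq_sum_graphs`).
[cite: BalabanImbrieJaffe1988, p.310 (Sect. 5.14)] -/
def Draw (ι : Type*) [Fintype ι] [DecidableEq ι] (K : Finset S) : ℝ :=
  ∑ Hs : ι → Finset S, ∑ Z : ι → Finset V,
    if OWP K Hs ∧ InQ Q Z ∧ Cov loc Hs Z then (rhoX Z univ (marked Hs) : ℝ) * wprod w Hs Z else 0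

/-- **The right side of the third display of p. 310** (the truncated function) in ORDERED raw form: the same with
`ρ^T(Z)` = *"Σ_{G_c} Π_{ℒ∈G_c} a(ℒ), G_c runs over connected graphs involving all clusters X_γ, Y_δ"* (the tree's
`UrsellTreeGraphBound.rhoT`, = the connected-graph sum by `UrsellTreeGraphBound.rhoT_eq_sum_graphs`).
[cite: BalabanImbrieJaffe1988, p.310 (Sect. 5.14)] -/
def Traw (ι : Type*) [Fintype ι] [DecidableEq ι] (K : Finset S) : ℝ :=
  ∑ Hs : ι → Finset S, ∑ Z : ι → Finset V,
    if OWP K Hs ∧ InQ Q Z ∧ Cov loc Hs Z then (rhoT Z univ : ℝ) * wprod w Hs Z else 0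

end Defs

/-! ## §2 Splitting the cluster slots into two groups -/

section Glue

variable {ι : Type*} [DecidableEq ι]

/-- gluing a function on the slots of `A` and a function on the other slots. [cite: BalabanImbrieJaffe1988, p.310 (Sect. 5.14)] -/
def glue (A : Finset ι) {β : Type*} (g₁ : {i // i ∈ A} → β) (g₂ : {i // i ∉ A} → β) : ι → β :=
  fun i => if h : i ∈ A then g₁ ⟨i, h⟩ else g₂ ⟨i, h⟩

variable {A : Finset ι} {β : Type*}

/-- the glued function on `A`. [cite: BalabanImbrieJaffe1988, p.310 (Sect. 5.14)] -/
theorem glue_of_mem (g₁ : {i // i ∈ A} → β) (g₂ : {i // i ∉ A} → β) {i : ι} (hi : i ∈ A) : glue A g₁ g₂ i = g₁ ⟨i, hi⟩ := by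
  unfold glue; rw [dif_pos hi]

/-- the glued function off `A`. [cite: BalabanImbrieJaffe1988, p.310 (Sect. 5.14)] -/
theorem glue_of_not_mem (g₁ : {i // i ∈ A} → β) (g₂ : {i // i ∉ A} → β) {i : ι} (hi : i ∉ A) :
    glue A g₁ g₂ i = g₂ ⟨i, hi⟩ := by
  unfold glue; rw [dif_neg hi]

/-- the glued function restricted to `A`. [cite: BalabanImbrieJaffe1988, p.310 (Sect. 5.14)] -/
@[simp] theorem glue_apply_mem (g₁ : {i // i ∈ A} → β) (g₂ : {i // i ∉ A} → β) (i : {i // i ∈ A}) :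
    glue A g₁ g₂ i.1 = g₁ i := glue_of_mem g₁ g₂ i.2

/-- the glued function restricted to the complement of `A`. [cite: BalabanImbrieJaffe1988, p.310 (Sect. 5.14)] -/
@[simp] theorem glue_apply_not_mem (g₁ : {i // i ∈ A} → β) (g₂ : {i // i ∉ A} → β) (i : {i // i ∉ A}) :
    glue A g₁ g₂ i.1 = g₂ i := glue_of_not_mem g₁ g₂ i.2

/-- **Summing over `ι`-indexed families = summing over the two restrictions.** [cite: BalabanImbrieJaffe1988, p.310 (Sect. 5.14)] -/
theorem sum_glue [Fintype ι] [Fintype β] {M : Type*} [AddCommMonoid M] (A : Finset ι) (F : (ι → β) → M) :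
    ∑ g, F g = ∑ g₁ : {i // i ∈ A} → β, ∑ g₂ : {i // i ∉ A} → β, F (glue A g₁ g₂) := by
  rw [← Fintype.sum_prod_type']
  refine Fintype.sum_equiv (Equiv.piEquivPiSubtypeProd (· ∈ A) (fun _ => β)) _ _ fun g => ?_
  congr 1
  funext i
  unfold glue
  split_ifs <;> rfl

/-- the product of a function of the slots splits along `A`. [cite: BalabanImbrieJaffe1988, p.310 (Sect. 5.14)] -/
theorem prod_eq_prod_mul_prod [Fintype ι] {M : Type*} [CommMonoid M] (A : Finset ι) (f : ι → M) :
    ∏ i, f i = (∏ i : {i // i ∈ A}, f i.1) * ∏ i : {i // i ∉ A}, f i.1 := by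
  convert (Fintype.prod_subtype_mul_prod_subtype (· ∈ A) f).symm

/-- `A.biUnion` of a glued family is the union of the first part. [cite: BalabanImbrieJaffe1988, p.310 (Sect. 5.14)] -/
theorem biUnion_glue_left [DecidableEq S] (Hs₁ : {i // i ∈ A} → Finset S) (Hs₂ : {i // i ∉ A} → Finset S) :
    A.biUnion (glue A Hs₁ Hs₂) = univ.biUnion Hs₁ := by
  ext j
  simp only [mem_biUnion, mem_univ, true_and]
  constructor
  · rintro ⟨i, hi, hj⟩
    exact ⟨⟨i, hi⟩, by rwa [glue_of_mem Hs₁ Hs₂ hi] at hj⟩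
  · rintro ⟨i, hj⟩
    exact ⟨i.1, i.2, by rwa [glue_apply_mem]⟩

/-- the complementary union of a glued family is the union of the second part. [cite: BalabanImbrieJaffe1988, p.310 (Sect. 5.14)] -/
theorem biUnion_glue_right [Fintype ι] [DecidableEq S] (Hs₁ : {i // i ∈ A} → Finset S) (Hs₂ : {i // i ∉ A} → Finset S) :
    (univ.filter fun i => i ∉ A).biUnion (glue A Hs₁ Hs₂) = univ.biUnion Hs₂ := by
  ext j
  simp only [mem_biUnion, mem_univ, true_and, mem_filter]
  constructor
  · rintro ⟨i, hi, hj⟩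
    exact ⟨⟨i, hi⟩, by rwa [glue_of_not_mem Hs₁ Hs₂ hi] at hj⟩
  · rintro ⟨i, hj⟩
    exact ⟨i.1, i.2, by rwa [glue_apply_not_mem]⟩

/-- the full union of a glued family. [cite: BalabanImbrieJaffe1988, p.310 (Sect. 5.14)] -/
theorem biUnion_glue [Fintype ι] [DecidableEq S] (Hs₁ : {i // i ∈ A} → Finset S) (Hs₂ : {i // i ∉ A} → Finset S) :
    univ.biUnion (glue A Hs₁ Hs₂) = univ.biUnion Hs₁ ∪ univ.biUnion Hs₂ := by
  rw [← biUnion_glue_left Hs₁ Hs₂, ← biUnion_glue_right Hs₁ Hs₂, ← union_biUnion]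
  have hu : A ∪ univ.filter (fun i => i ∉ A) = univ := by
    ext i
    by_cases h : i ∈ A <;> simp [h]
  rw [hu]

/-- **The labelling constraint splits.** For `b ⊆ K`: the glued blocks form an ordered weak partition of `K` whose `A`-part covers
exactly `b` iff the first part is an ordered weak partition of `b` and the second one of `K ∖ b`.
[cite: BalabanImbrieJaffe1988, p.310 (Sect. 5.14)] -/
theorem owp_glue_iff [Fintype ι] [DecidableEq S] {K b : Finset S} (hbK : b ⊆ K) (Hs₁ : {i // i ∈ A} → Finset S)
    (Hs₂ : {i // i ∉ A} → Finset S) :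
    (OWP K (glue A Hs₁ Hs₂) ∧ A.biUnion (glue A Hs₁ Hs₂) = b) ↔ (OWP b Hs₁ ∧ OWP (K \ b) Hs₂) := by
  rw [biUnion_glue_left]
  constructor
  · rintro ⟨⟨hpd, hu⟩, hb⟩
    have hpd₁ : ∀ i i' : {i // i ∈ A}, i ≠ i' → Disjoint (Hs₁ i) (Hs₁ i') := fun i i' hne => by
      rw [← glue_apply_mem Hs₁ Hs₂ i, ← glue_apply_mem Hs₁ Hs₂ i']
      exact hpd _ _ fun h => hne (Subtype.ext h)
    have hpd₂ : ∀ i i' : {i // i ∉ A}, i ≠ i' → Disjoint (Hs₂ i) (Hs₂ i') := fun i i' hne => by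
      rw [← glue_apply_not_mem Hs₁ Hs₂ i, ← glue_apply_not_mem Hs₁ Hs₂ i']
      exact hpd _ _ fun h => hne (Subtype.ext h)
    have hdisj : Disjoint (univ.biUnion Hs₁) (univ.biUnion Hs₂) := by
      rw [disjoint_biUnion_left]
      intro i _
      rw [disjoint_biUnion_right]
      intro i' _
      rw [← glue_apply_mem Hs₁ Hs₂ i, ← glue_apply_not_mem Hs₁ Hs₂ i']
      exact hpd _ _ fun h => i'.2 (h ▸ i.2)
    refine ⟨⟨hpd₁, hb⟩, hpd₂, ?_⟩
    rw [biUnion_glue, hb] at hu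
    rw [← hu, union_sdiff_cancel_left (hb ▸ hdisj)]
  · rintro ⟨⟨hpd₁, hu₁⟩, hpd₂, hu₂⟩
    refine ⟨⟨fun i i' hne => ?_, ?_⟩, hu₁⟩
    · by_cases hi : i ∈ A <;> by_cases hi' : i' ∈ A
      · rw [glue_of_mem Hs₁ Hs₂ hi, glue_of_mem Hs₁ Hs₂ hi']
        exact hpd₁ ⟨i, hi⟩ ⟨i', hi'⟩ fun h => hne (congrArg Subtype.val h)
      · have h1 : glue A Hs₁ Hs₂ i ⊆ b := by
          rw [← hu₁, glue_of_mem Hs₁ Hs₂ hi]; exact subset_biUnion_of_mem Hs₁ (mem_univ _)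
        have h2 : glue A Hs₁ Hs₂ i' ⊆ K \ b := by
          rw [← hu₂, glue_of_not_mem Hs₁ Hs₂ hi']; exact subset_biUnion_of_mem Hs₂ (mem_univ _)
        exact disjoint_of_subset_left h1 (disjoint_of_subset_right h2 disjoint_sdiff)
      · have h1 : glue A Hs₁ Hs₂ i ⊆ K \ b := by
          rw [← hu₂, glue_of_not_mem Hs₁ Hs₂ hi]; exact subset_biUnion_of_mem Hs₂ (mem_univ _)
        have h2 : glue A Hs₁ Hs₂ i' ⊆ b := by
          rw [← hu₁, glue_of_mem Hs₁ Hs₂ hi']; exact subset_biUnion_of_mem Hs₁ (mem_univ _)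
        exact disjoint_of_subset_left h1 (disjoint_of_subset_right h2 sdiff_disjoint)
      · rw [glue_of_not_mem Hs₁ Hs₂ hi, glue_of_not_mem Hs₁ Hs₂ hi']
        exact hpd₂ ⟨i, hi⟩ ⟨i', hi'⟩ fun h => hne (congrArg Subtype.val h)
    · rw [biUnion_glue, hu₁, hu₂, union_sdiff_of_subset hbK]

/-- the polymer condition splits. [cite: BalabanImbrieJaffe1988, p.310 (Sect. 5.14)] -/
theorem inQ_glue_iff (Q : Finset (Finset V)) (Z₁ : {i // i ∈ A} → Finset V) (Z₂ : {i // i ∉ A} → Finset V) :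
    InQ Q (glue A Z₁ Z₂) ↔ InQ Q Z₁ ∧ InQ Q Z₂ := by
  constructor
  · intro h
    exact ⟨fun i => by rw [← glue_apply_mem Z₁ Z₂ i]; exact h _, fun i => by rw [← glue_apply_not_mem Z₁ Z₂ i]; exact h _⟩
  · rintro ⟨h₁, h₂⟩ i
    by_cases hi : i ∈ A
    · rw [glue_of_mem Z₁ Z₂ hi]; exact h₁ _
    · rw [glue_of_not_mem Z₁ Z₂ hi]; exact h₂ _

/-- the covering condition splits. [cite: BalabanImbrieJaffe1988, p.309 (Sect. 5.14)] -/
theorem cov_glue_iff (loc : S → V) (Hs₁ : {i // i ∈ A} → Finset S) (Hs₂ : {i // i ∉ A} → Finset S)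
    (Z₁ : {i // i ∈ A} → Finset V) (Z₂ : {i // i ∉ A} → Finset V) :
    Cov loc (glue A Hs₁ Hs₂) (glue A Z₁ Z₂) ↔ Cov loc Hs₁ Z₁ ∧ Cov loc Hs₂ Z₂ := by
  constructor
  · intro h
    refine ⟨fun i j hj => ?_, fun i j hj => ?_⟩
    · rw [← glue_apply_mem Z₁ Z₂ i]; rw [← glue_apply_mem Hs₁ Hs₂ i] at hj; exact h _ j hj
    · rw [← glue_apply_not_mem Z₁ Z₂ i]; rw [← glue_apply_not_mem Hs₁ Hs₂ i] at hj; exact h _ j hj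
  · rintro ⟨h₁, h₂⟩ i j hj
    by_cases hi : i ∈ A
    · rw [glue_of_mem Z₁ Z₂ hi]; rw [glue_of_mem Hs₁ Hs₂ hi] at hj; exact h₁ _ j hj
    · rw [glue_of_not_mem Z₁ Z₂ hi]; rw [glue_of_not_mem Hs₁ Hs₂ hi] at hj; exact h₂ _ j hj

variable [Fintype ι] [DecidableEq V] [Fintype V] [DecidableEq S] [Fintype S] (Q : Finset (Finset V)) (loc : S → V)

/-- **THE SPLITTING ENGINE.** A sum over the `ι`-indexed labelled families constrained by `OWP K` with the `A`-slots carrying exactly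
the derivative set `b ⊆ K`, of a weight that factors through the two restrictions, is the product of the constrained sums over
the `A`-indexed and the `Aᶜ`-indexed families (with `OWP b`, resp. `OWP (K ∖ b)`). [cite: BalabanImbrieJaffe1988, p.310 (Sect. 5.14)] -/
theorem split_core (A : Finset ι) {K b : Finset S} (hbK : b ⊆ K)
    (φ : ({i // i ∈ A} → Finset S) → ({i // i ∈ A} → Finset V) → ℝ)
    (ψ : ({i // i ∉ A} → Finset S) → ({i // i ∉ A} → Finset V) → ℝ) :
    ∑ Hs : ι → Finset S, ∑ Z : ι → Finset V,
      (if (OWP K Hs ∧ A.biUnion Hs = b) ∧ InQ Q Z ∧ Cov loc Hs Z then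
        φ (fun i => Hs i.1) (fun i => Z i.1) * ψ (fun i => Hs i.1) (fun i => Z i.1) else 0) =
    (∑ Hs₁ : {i // i ∈ A} → Finset S, ∑ Z₁ : {i // i ∈ A} → Finset V,
        if OWP b Hs₁ ∧ InQ Q Z₁ ∧ Cov loc Hs₁ Z₁ then φ Hs₁ Z₁ else 0) *
    (∑ Hs₂ : {i // i ∉ A} → Finset S, ∑ Z₂ : {i // i ∉ A} → Finset V,
        if OWP (K \ b) Hs₂ ∧ InQ Q Z₂ ∧ Cov loc Hs₂ Z₂ then ψ Hs₂ Z₂ else 0) := by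
  have step : ∀ (Hs₁ : {i // i ∈ A} → Finset S) (Hs₂ : {i // i ∉ A} → Finset S),
      ∑ Z : ι → Finset V, (if (OWP K (glue A Hs₁ Hs₂) ∧ A.biUnion (glue A Hs₁ Hs₂) = b) ∧ InQ Q Z ∧
        Cov loc (glue A Hs₁ Hs₂) Z then φ (fun i => glue A Hs₁ Hs₂ i.1) (fun i => Z i.1) *
          ψ (fun i => glue A Hs₁ Hs₂ i.1) (fun i => Z i.1) else 0) =
      ∑ Z₁ : {i // i ∈ A} → Finset V, ∑ Z₂ : {i // i ∉ A} → Finset V,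
        if (OWP b Hs₁ ∧ InQ Q Z₁ ∧ Cov loc Hs₁ Z₁) ∧ (OWP (K \ b) Hs₂ ∧ InQ Q Z₂ ∧ Cov loc Hs₂ Z₂) then
          φ Hs₁ Z₁ * ψ Hs₂ Z₂ else 0 := by
    intro Hs₁ Hs₂
    rw [sum_glue A]
    refine sum_congr rfl fun Z₁ _ => sum_congr rfl fun Z₂ _ => ?_
    simp only [glue_apply_mem, glue_apply_not_mem]
    have hc : ((OWP K (glue A Hs₁ Hs₂) ∧ A.biUnion (glue A Hs₁ Hs₂) = b) ∧ InQ Q (glue A Z₁ Z₂) ∧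
        Cov loc (glue A Hs₁ Hs₂) (glue A Z₁ Z₂)) ↔
        ((OWP b Hs₁ ∧ InQ Q Z₁ ∧ Cov loc Hs₁ Z₁) ∧ (OWP (K \ b) Hs₂ ∧ InQ Q Z₂ ∧ Cov loc Hs₂ Z₂)) := by
      rw [owp_glue_iff hbK, inQ_glue_iff, cov_glue_iff]
      tauto
    by_cases h : (OWP b Hs₁ ∧ InQ Q Z₁ ∧ Cov loc Hs₁ Z₁) ∧ (OWP (K \ b) Hs₂ ∧ InQ Q Z₂ ∧ Cov loc Hs₂ Z₂)
    · rw [if_pos h, if_pos (hc.2 h)]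
    · rw [if_neg h, if_neg (mt hc.1 h)]
  rw [sum_glue A]
  rw [sum_congr rfl fun Hs₁ _ => sum_congr rfl fun Hs₂ _ => step Hs₁ Hs₂]
  rw [sum_mul_sum]
  refine sum_congr rfl fun Hs₁ _ => sum_congr rfl fun Hs₂ _ => ?_
  rw [sum_mul_sum]
  refine sum_congr rfl fun Z₁ _ => sum_congr rfl fun Z₂ _ => ?_
  rw [ite_zero_mul_ite_zero]

end Glue

/-! ## §3 Relabelling the cluster slots -/

section Relabel

variable {ι : Type*} [Fintype ι] {κ : Type*} [Fintype κ]

/-- sums over `κ`-indexed families along an equivalence `ι ≃ κ`. [cite: BalabanImbrieJaffe1988, p.310 (Sect. 5.14)] -/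
theorem sum_fun_equiv [DecidableEq ι] [DecidableEq κ] {β : Type*} [Fintype β] {M : Type*} [AddCommMonoid M] (e : ι ≃ κ)
    (F : (κ → β) → M) : ∑ g : κ → β, F g = ∑ g : ι → β, F (g ∘ e.symm) :=
  (Equiv.sum_comp (e.arrowCongr (Equiv.refl β)) F).symm

/-- `OWP` is invariant under relabelling. [cite: BalabanImbrieJaffe1988, p.310 (Sect. 5.14)] -/
theorem owp_comp_iff [DecidableEq S] (e : ι ≃ κ) (K : Finset S) (Hs : ι → Finset S) : OWP K (Hs ∘ e.symm) ↔ OWP K Hs := by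
  have hU : (univ : Finset κ).biUnion (Hs ∘ e.symm) = univ.biUnion Hs := by
    ext j
    simp only [mem_biUnion, mem_univ, true_and, Function.comp_apply]
    exact ⟨fun ⟨k, hk⟩ => ⟨e.symm k, hk⟩, fun ⟨i, hi⟩ => ⟨e i, by simpa using hi⟩⟩
  unfold OWP
  rw [hU]
  refine and_congr ⟨fun h i i' hne => ?_, fun h k k' hne => h _ _ fun h' => hne (e.symm.injective h')⟩ Iff.rfl
  have := h (e i) (e i') fun h' => hne (e.injective h')
  simpa using this

omit [Fintype ι] [Fintype κ] in
/-- `InQ` is invariant under relabelling. [cite: BalabanImbrieJaffe1988, p.310 (Sect. 5.14)] -/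
theorem inQ_comp_iff (e : ι ≃ κ) (Q : Finset (Finset V)) (Z : ι → Finset V) : InQ Q (Z ∘ e.symm) ↔ InQ Q Z :=
  ⟨fun h i => by simpa using h (e i), fun h k => h _⟩

omit [Fintype ι] [Fintype κ] in
/-- `Cov` is invariant under relabelling. [cite: BalabanImbrieJaffe1988, p.309 (Sect. 5.14)] -/
theorem cov_comp_iff (e : ι ≃ κ) (loc : S → V) (Hs : ι → Finset S) (Z : ι → Finset V) :
    Cov loc (Hs ∘ e.symm) (Z ∘ e.symm) ↔ Cov loc Hs Z :=
  ⟨fun h i j hj => by simpa using h (e i) j (by simpa using hj), fun h k j hj => h _ j hj⟩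

/-- the hard core is invariant under relabelling. [cite: BalabanImbrieJaffe1988, p.310 (Sect. 5.14)] -/
theorem hardCore_comp [DecidableEq ι] [DecidableEq κ] [DecidableEq V] (e : ι ≃ κ) (Z : ι → Finset V) :
    hardCore (Z ∘ e.symm) (univ : Finset κ) = hardCore Z univ := by
  have hiff : (∀ k ∈ (univ : Finset κ), ∀ k' ∈ (univ : Finset κ), k ≠ k' → Disjoint ((Z ∘ e.symm) k) ((Z ∘ e.symm) k')) ↔
      ∀ i ∈ (univ : Finset ι), ∀ i' ∈ (univ : Finset ι), i ≠ i' → Disjoint (Z i) (Z i') := by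
    refine ⟨fun h i _ i' _ hne => ?_, fun h k _ k' _ hne => h _ (mem_univ _) _ (mem_univ _)
      fun h' => hne (e.symm.injective h')⟩
    have := h (e i) (mem_univ _) (e i') (mem_univ _) fun h' => hne (e.injective h')
    simpa using this
  unfold hardCore
  by_cases h : ∀ i ∈ (univ : Finset ι), ∀ i' ∈ (univ : Finset ι), i ≠ i' → Disjoint (Z i) (Z i')
  · rw [if_pos h, if_pos (hiff.2 h)]
  · rw [if_neg h, if_neg (mt hiff.1 h)]

/-- `ρ^T` of the whole family is invariant under relabelling. [cite: BalabanImbrieJaffe1988, p.310 (Sect. 5.14)] -/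
theorem rhoT_comp [DecidableEq ι] [DecidableEq κ] [DecidableEq V] (e : ι ≃ κ) (Z : ι → Finset V) :
    rhoT (Z ∘ e.symm) (univ : Finset κ) = rhoT Z univ := by
  have h := rhoT_map e.symm.toEmbedding Z univ
  rw [map_univ_equiv] at h
  exact h.symm

/-- `marked` transports under relabelling. [cite: BalabanImbrieJaffe1988, p.310 (Sect. 5.14)] -/
theorem marked_comp_map (e : ι ≃ κ) (Hs : ι → Finset S) : (marked (Hs ∘ e.symm)).map e.symm.toEmbedding = marked Hs := by
  ext i
  simp only [marked, mem_map, mem_filter, mem_univ, true_and, Function.comp_apply, Equiv.coe_toEmbedding]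
  constructor
  · rintro ⟨k, hk, rfl⟩; exact hk
  · intro hi; exact ⟨e i, by simpa using hi, by simp⟩

/-- `ρX` rooted at the labelled slots is invariant under relabelling. [cite: BalabanImbrieJaffe1988, p.310 (Sect. 5.14)] -/
theorem rhoX_comp [DecidableEq ι] [DecidableEq κ] [DecidableEq V] (e : ι ≃ κ) (Hs : ι → Finset S) (Z : ι → Finset V) :
    rhoX (Z ∘ e.symm) (univ : Finset κ) (marked (Hs ∘ e.symm)) = rhoX Z univ (marked Hs) := by
  have h := rhoX_map e.symm.toEmbedding Z univ (marked (Hs ∘ e.symm))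
  rw [map_univ_equiv, marked_comp_map] at h
  exact h.symm

/-- the activity product is invariant under relabelling. [cite: BalabanImbrieJaffe1988, p.310 (Sect. 5.14)] -/
theorem wprod_comp (e : ι ≃ κ) (w : Finset S → Finset V → ℝ) (Hs : ι → Finset S) (Z : ι → Finset V) :
    wprod w (Hs ∘ e.symm) (Z ∘ e.symm) = wprod w Hs Z := by
  unfold wprod
  exact Equiv.prod_comp e.symm (fun i => w (Hs i) (Z i))

variable [DecidableEq ι] [DecidableEq κ] [DecidableEq V] [Fintype V] [DecidableEq S] [Fintype S] (Q : Finset (Finset V))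
  (loc : S → V) (w : Finset S → Finset V → ℝ)

/-- relabelling a constrained family sum whose extra weight is invariant. [cite: BalabanImbrieJaffe1988, p.310 (Sect. 5.14)] -/
theorem sum_relabel (e : ι ≃ κ) (K : Finset S) (rκ : (κ → Finset S) → (κ → Finset V) → ℝ)
    (rι : (ι → Finset S) → (ι → Finset V) → ℝ) (hr : ∀ Hs Z, rκ (Hs ∘ e.symm) (Z ∘ e.symm) = rι Hs Z) :
    ∑ Hs : κ → Finset S, ∑ Z : κ → Finset V, (if OWP K Hs ∧ InQ Q Z ∧ Cov loc Hs Z then rκ Hs Z * wprod w Hs Z else 0) =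
      ∑ Hs : ι → Finset S, ∑ Z : ι → Finset V, (if OWP K Hs ∧ InQ Q Z ∧ Cov loc Hs Z then rι Hs Z * wprod w Hs Z else 0) := by
  rw [sum_fun_equiv e]
  refine sum_congr rfl fun Hs _ => ?_
  rw [sum_fun_equiv e]
  refine sum_congr rfl fun Z _ => ?_
  have hc : (OWP K (Hs ∘ e.symm) ∧ InQ Q (Z ∘ e.symm) ∧ Cov loc (Hs ∘ e.symm) (Z ∘ e.symm)) ↔
      (OWP K Hs ∧ InQ Q Z ∧ Cov loc Hs Z) := by
    rw [owp_comp_iff, inQ_comp_iff, cov_comp_iff]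
  by_cases h : OWP K Hs ∧ InQ Q Z ∧ Cov loc Hs Z
  · rw [if_pos h, if_pos (hc.2 h), hr, wprod_comp]
  · rw [if_neg h, if_neg (mt hc.1 h)]

/-- `Nraw` is invariant under relabelling of the cluster slots. [cite: BalabanImbrieJaffe1988, p.309 (Sect. 5.14)] -/
theorem Nraw_congr (e : ι ≃ κ) (K : Finset S) : Nraw Q loc w κ K = Nraw Q loc w ι K :=
  sum_relabel Q loc w e K (fun _ Z => (hardCore Z univ : ℝ)) (fun _ Z => (hardCore Z univ : ℝ))
    fun _ Z => by rw [hardCore_comp]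

/-- `Traw` is invariant under relabelling of the cluster slots. [cite: BalabanImbrieJaffe1988, p.310 (Sect. 5.14)] -/
theorem Traw_congr (e : ι ≃ κ) (K : Finset S) : Traw Q loc w κ K = Traw Q loc w ι K :=
  sum_relabel Q loc w e K (fun _ Z => (rhoT Z univ : ℝ)) (fun _ Z => (rhoT Z univ : ℝ)) fun _ Z => by rw [rhoT_comp]

/-- `Draw` is invariant under relabelling of the cluster slots. [cite: BalabanImbrieJaffe1988, p.310 (Sect. 5.14)] -/
theorem Draw_congr (e : ι ≃ κ) (K : Finset S) : Draw Q loc w κ K = Draw Q loc w ι K :=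
  sum_relabel Q loc w e K (fun Hs Z => (rhoX Z univ (marked Hs) : ℝ)) (fun Hs Z => (rhoX Z univ (marked Hs) : ℝ))
    fun Hs Z => by rw [rhoX_comp]

end Relabel

/-! ## §4 Restriction of the graph coefficients to a group of slots -/

section Restrict

variable {ι : Type*} [Fintype ι] [DecidableEq ι] [DecidableEq V]

omit [Fintype ι] [DecidableEq ι] [DecidableEq V] in
/-- the univ of the slots of `A`, mapped back, is `A`. [folklore] -/
private theorem univ_map_subtype_mem (A : Finset ι) :
    (univ : Finset {i // i ∈ A}).map (Function.Embedding.subtype (· ∈ A)) = A := by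
  rw [univ_eq_attach, attach_map_val]

omit [DecidableEq V] in
/-- the univ of the slots off `A`, mapped back, is the complement. [folklore] -/
private theorem univ_map_subtype_not_mem (A : Finset ι) :
    (univ : Finset {i // i ∉ A}).map (Function.Embedding.subtype (· ∉ A)) = univ \ A := by
  rw [univ_map_subtype]
  ext i
  simp

omit [DecidableEq V] in
/-- the roots among the slots of `A`. [cite: BalabanImbrieJaffe1988, p.310 (Sect. 5.14)] -/
theorem marked_restrict_map (A : Finset ι) (Hs : ι → Finset S) :
    (marked fun i : {i // i ∈ A} => Hs i.1).map (Function.Embedding.subtype (· ∈ A)) = A ∩ marked Hs := by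
  ext i
  simp only [marked, mem_map, mem_filter, mem_univ, true_and, mem_inter, Function.Embedding.coe_subtype]
  constructor
  · rintro ⟨x, hx, rfl⟩; exact ⟨x.2, hx⟩
  · rintro ⟨hi, hx⟩; exact ⟨⟨i, hi⟩, hx, rfl⟩

omit [DecidableEq V] in
/-- the roots among the slots off `B`. [cite: BalabanImbrieJaffe1988, p.310 (Sect. 5.14)] -/
theorem marked_restrict_compl_map (B : Finset ι) (Hs : ι → Finset S) :
    (marked fun i : {i // i ∉ B} => Hs i.1).map (Function.Embedding.subtype (· ∉ B)) = (univ \ B) ∩ marked Hs := by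
  ext i
  simp only [marked, mem_map, mem_filter, mem_univ, true_and, mem_inter, mem_sdiff, Function.Embedding.coe_subtype]
  constructor
  · rintro ⟨x, hx, rfl⟩; exact ⟨x.2, hx⟩
  · rintro ⟨hi, hx⟩; exact ⟨⟨i, hi⟩, hx, rfl⟩

/-- `ρX` of the slots of `A`, rooted at the labelled ones, is `ρX` of the restricted family.
[cite: BalabanImbrieJaffe1988, p.310 (Sect. 5.14)] -/
theorem rhoX_restrict (A : Finset ι) (Hs : ι → Finset S) (Z : ι → Finset V) :
    rhoX Z A (marked Hs) = rhoX (fun i : {i // i ∈ A} => Z i.1) univ (marked fun i : {i // i ∈ A} => Hs i.1) := by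
  have h := rhoX_map (Function.Embedding.subtype (· ∈ A)) Z univ (marked fun i : {i // i ∈ A} => Hs i.1)
  rw [univ_map_subtype_mem, marked_restrict_map, ← rhoX_root_inter] at h
  exact h

/-- `ρX` of the slots off `B`, rooted at the labelled ones, is `ρX` of the restricted family.
[cite: BalabanImbrieJaffe1988, p.310 (Sect. 5.14)] -/
theorem rhoX_restrict_compl (B : Finset ι) (Hs : ι → Finset S) (Z : ι → Finset V) :
    rhoX Z (univ \ B) (marked Hs) =
      rhoX (fun i : {i // i ∉ B} => Z i.1) univ (marked fun i : {i // i ∉ B} => Hs i.1) := by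
  have h := rhoX_map (Function.Embedding.subtype (· ∉ B)) Z univ (marked fun i : {i // i ∉ B} => Hs i.1)
  rw [univ_map_subtype_not_mem, marked_restrict_compl_map, ← rhoX_root_inter] at h
  exact h

omit [Fintype ι] in
/-- `ρ^T` of a block is `ρ^T` of the restricted family. [cite: BalabanImbrieJaffe1988, p.310 (Sect. 5.14)] -/
theorem rhoT_restrict (B : Finset ι) (Z : ι → Finset V) : rhoT Z B = rhoT (fun i : {i // i ∈ B} => Z i.1) univ := by
  have h := rhoT_map (Function.Embedding.subtype (· ∈ B)) Z univ
  rw [univ_map_subtype_mem] at h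
  exact h

/-- the hard core of the slots off `A` is the hard core of the restricted family. [cite: BalabanImbrieJaffe1988, p.310 (Sect. 5.14)] -/
theorem hardCore_restrict_compl (A : Finset ι) (Z : ι → Finset V) :
    hardCore Z (univ \ A) = hardCore (fun i : {i // i ∉ A} => Z i.1) univ := by
  have hiff : (∀ i ∈ univ \ A, ∀ i' ∈ univ \ A, i ≠ i' → Disjoint (Z i) (Z i')) ↔
      ∀ x ∈ (univ : Finset {i // i ∉ A}), ∀ x' ∈ (univ : Finset {i // i ∉ A}), x ≠ x' → Disjoint (Z x.1) (Z x'.1) := by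
    constructor
    · intro h x _ x' _ hne
      exact h x.1 (mem_sdiff.2 ⟨mem_univ _, x.2⟩) x'.1 (mem_sdiff.2 ⟨mem_univ _, x'.2⟩) fun h' => hne (Subtype.ext h')
    · intro h i hi i' hi' hne
      exact h ⟨i, (mem_sdiff.1 hi).2⟩ (mem_univ _) ⟨i', (mem_sdiff.1 hi').2⟩ (mem_univ _)
        fun h' => hne (congrArg Subtype.val h')
  unfold hardCore
  by_cases h : ∀ i ∈ univ \ A, ∀ i' ∈ univ \ A, i ≠ i' → Disjoint (Z i) (Z i')
  · rw [if_pos h, if_pos (hiff.1 h)]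
  · rw [if_neg h, if_neg (mt hiff.2 h)]

omit [DecidableEq V] in
/-- the activity product splits along `A`. [cite: BalabanImbrieJaffe1988, p.310 (Sect. 5.14)] -/
theorem wprod_split (w : Finset S → Finset V → ℝ) (A : Finset ι) (Hs : ι → Finset S) (Z : ι → Finset V) :
    wprod w Hs Z = wprod w (fun i : {i // i ∈ A} => Hs i.1) (fun i : {i // i ∈ A} => Z i.1) *
      wprod w (fun i : {i // i ∉ A} => Hs i.1) (fun i : {i // i ∉ A} => Z i.1) := by
  unfold wprod
  exact prod_eq_prod_mul_prod A fun i => w (Hs i) (Z i)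

end Restrict

/-! ## §5 *"This enables us to factor out the normalization"*: the un-normalized expansion = (rooted sum) × (hard-core sum) -/

section Conv

variable {ι : Type*} [Fintype ι] [DecidableEq ι]

/-- under `OWP K`: the roots lie in `A` iff the `A`-slots carry all of `K`. [cite: BalabanImbrieJaffe1988, p.310 (Sect. 5.14)] -/
theorem marked_subset_iff [DecidableEq S] {K : Finset S} {Hs : ι → Finset S} (h : OWP K Hs) (A : Finset ι) :
    marked Hs ⊆ A ↔ A.biUnion Hs = K := by
  obtain ⟨hpd, hu⟩ := h
  constructor
  · intro hA
    refine Subset.antisymm (fun j hj => ?_) fun j hj => ?_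
    · rw [← hu]
      exact biUnion_subset_biUnion_of_subset_left Hs (subset_univ A) hj
    · rw [← hu] at hj
      obtain ⟨i, -, hji⟩ := mem_biUnion.1 hj
      exact mem_biUnion.2 ⟨i, hA (mem_filter.2 ⟨mem_univ _, ⟨j, hji⟩⟩), hji⟩
  · intro hA i hi
    obtain ⟨j, hj⟩ := (mem_filter.1 hi).2
    have hjK : j ∈ K := by rw [← hu]; exact mem_biUnion.2 ⟨i, mem_univ _, hj⟩
    rw [← hA] at hjK
    obtain ⟨i', hi', hji'⟩ := mem_biUnion.1 hjK
    by_cases hii : i = i'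
    · exact hii ▸ hi'
    · exact absurd hji' (disjoint_left.1 (hpd i i' hii) hj)

variable [DecidableEq V] [Fintype V] [DecidableEq S] [Fintype S] (Q : Finset (Finset V)) (loc : S → V)
  (w : Finset S → Finset V → ℝ)

/-- **DISPLAY 1 OF P. 310, RAW FORM** (*"We put u = 1 + a and expand in the usual manner. This enables us to factor out the
normalization z_t(Λ₁₂^{(k)})"*): the un-normalized expansion over `ι`-indexed families splits as the sum over the set `A` of slots
connected to the roots of (the rooted sum over the `A`-indexed families) × (the hard-core sum over the remaining families with no
derivatives) — the second factor is the normalization. [cite: BalabanImbrieJaffe1988, p.310 (Sect. 5.14)] -/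
theorem Nraw_eq_sum_Draw_mul (K : Finset S) :
    Nraw Q loc w ι K = ∑ A : Finset ι, Draw Q loc w {i // i ∈ A} K * Nraw Q loc w {i // i ∉ A} ∅ := by
  have h1 : ∀ (Hs : ι → Finset S) (Z : ι → Finset V),
      (if OWP K Hs ∧ InQ Q Z ∧ Cov loc Hs Z then (hardCore Z univ : ℝ) * wprod w Hs Z else 0) =
      ∑ A : Finset ι, (if (OWP K Hs ∧ A.biUnion Hs = K) ∧ InQ Q Z ∧ Cov loc Hs Z then
        (rhoX (fun i : {i // i ∈ A} => Z i.1) univ (marked fun i : {i // i ∈ A} => Hs i.1) : ℝ) *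
          wprod w (fun i : {i // i ∈ A} => Hs i.1) (fun i : {i // i ∈ A} => Z i.1) *
        ((hardCore (fun i : {i // i ∉ A} => Z i.1) univ : ℝ) *
          wprod w (fun i : {i // i ∉ A} => Hs i.1) (fun i : {i // i ∉ A} => Z i.1)) else 0) := by
    intro Hs Z
    by_cases hc : OWP K Hs ∧ InQ Q Z ∧ Cov loc Hs Z
    · rw [if_pos hc, rooted_sunset Z univ (marked Hs), Int.cast_sum, sum_mul, sum_filter, powerset_univ]
      refine sum_congr rfl fun A _ => ?_
      rw [univ_inter]
      by_cases hA : A.biUnion Hs = K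
      · rw [if_pos ((marked_subset_iff hc.1 A).2 hA), if_pos ⟨⟨hc.1, hA⟩, hc.2⟩, Int.cast_mul, rhoX_restrict,
          hardCore_restrict_compl, wprod_split w A Hs Z]
        ring
      · rw [if_neg (mt (marked_subset_iff hc.1 A).1 hA), if_neg fun h => hA h.1.2]
    · rw [if_neg hc]
      symm
      exact sum_eq_zero fun A _ => if_neg fun h => hc ⟨h.1.1, h.2⟩
  unfold Nraw Draw
  rw [sum_congr rfl fun Hs _ => sum_congr rfl fun Z _ => h1 Hs Z]
  rw [sum_congr rfl fun Hs _ => sum_comm, sum_comm]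
  refine sum_congr rfl fun A _ => ?_
  have h3 := split_core Q loc A (Subset.refl K)
    (fun Hs₁ Z₁ => (rhoX Z₁ univ (marked Hs₁) : ℝ) * wprod w Hs₁ Z₁)
    (fun Hs₂ Z₂ => (hardCore Z₂ univ : ℝ) * wprod w Hs₂ Z₂)
  have hKK : K \ K = (∅ : Finset S) := by simp
  rw [hKK] at h3
  rw [← h3]

end Conv

/-! ## §6 The recursion over the block of the root (towards displays 2 and 3 of p. 310) -/

section Rooted

variable {ι : Type*} [Fintype ι] [DecidableEq ι] [DecidableEq S]

omit [DecidableEq ι] in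
/-- under `OWP K`, every slot of `K` is carried by some cluster. [cite: BalabanImbrieJaffe1988, p.310 (Sect. 5.14)] -/
theorem exists_carrier {K : Finset S} {Hs : ι → Finset S} (h : OWP K Hs) {j : S} (hj : j ∈ K) : ∃ i, j ∈ Hs i := by
  rw [← h.2] at hj
  obtain ⟨i, -, hi⟩ := mem_biUnion.1 hj
  exact ⟨i, hi⟩

/-- under `OWP K`, the carrier is unique (*"no duplication of t-derivatives"*). [cite: BalabanImbrieJaffe1988, p.310 (Sect. 5.14)] -/
theorem carrier_unique {K : Finset S} {Hs : ι → Finset S} (h : OWP K Hs) {j : S} {i i' : ι} (hi : j ∈ Hs i) (hi' : j ∈ Hs i') :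
    i = i' := by
  by_contra hne
  exact disjoint_left.1 (h.1 i i' hne) hi hi'

/-- under `OWP K` with `j₀ ∈ Hs i₀`: the `B`-slots carry `j₀` iff `i₀ ∈ B`. [cite: BalabanImbrieJaffe1988, p.310 (Sect. 5.14)] -/
theorem mem_biUnion_iff_mem {K : Finset S} {Hs : ι → Finset S} (h : OWP K Hs) {j₀ : S} {i₀ : ι} (hi₀ : j₀ ∈ Hs i₀)
    (B : Finset ι) : j₀ ∈ B.biUnion Hs ↔ i₀ ∈ B := by
  constructor
  · intro hj
    obtain ⟨i, hi, hji⟩ := mem_biUnion.1 hj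
    exact (carrier_unique h hi₀ hji) ▸ hi
  · intro hi₀B
    exact mem_biUnion.2 ⟨i₀, hi₀B, hi₀⟩

variable [DecidableEq V] [Fintype V] [Fintype S] (Q : Finset (Finset V)) (loc : S → V) (w : Finset S → Finset V → ℝ)

/-- **THE ROOTED RECURSION, RAW FORM** (*"The connected components of G define a partition of H"*, read at the component of the root
`j₀`): the rooted sum over `ι`-indexed families = the sum over the derivative set `b ∋ j₀` carried by the component of `j₀`'s cluster
and over its slot set `B` of (the connected sum over the `B`-families carrying `b`) × (the rooted sum over the remaining families
carrying `K ∖ b`). [cite: BalabanImbrieJaffe1988, p.310 (Sect. 5.14)] -/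
theorem Draw_eq_sum_Traw_mul (K : Finset S) {j₀ : S} (hj : j₀ ∈ K) :
    Draw Q loc w ι K = ∑ b ∈ K.powerset.filter (fun b => j₀ ∈ b), ∑ B : Finset ι,
      Traw Q loc w {i // i ∈ B} b * Draw Q loc w {i // i ∉ B} (K \ b) := by
  have h1 : ∀ (Hs : ι → Finset S) (Z : ι → Finset V),
      (if OWP K Hs ∧ InQ Q Z ∧ Cov loc Hs Z then (rhoX Z univ (marked Hs) : ℝ) * wprod w Hs Z else 0) =
      ∑ b ∈ K.powerset.filter (fun b => j₀ ∈ b), ∑ B : Finset ι,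
        (if (OWP K Hs ∧ B.biUnion Hs = b) ∧ InQ Q Z ∧ Cov loc Hs Z then
          (rhoT (fun i : {i // i ∈ B} => Z i.1) univ : ℝ) *
            wprod w (fun i : {i // i ∈ B} => Hs i.1) (fun i : {i // i ∈ B} => Z i.1) *
          ((rhoX (fun i : {i // i ∉ B} => Z i.1) univ (marked fun i : {i // i ∉ B} => Hs i.1) : ℝ) *
            wprod w (fun i : {i // i ∉ B} => Hs i.1) (fun i : {i // i ∉ B} => Z i.1)) else 0) := by
    intro Hs Z
    by_cases hc : OWP K Hs ∧ InQ Q Z ∧ Cov loc Hs Z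
    · obtain ⟨i₀, hi₀⟩ := exists_carrier hc.1 hj
      have hi₀m : i₀ ∈ marked Hs := mem_filter.2 ⟨mem_univ _, ⟨j₀, hi₀⟩⟩
      -- the block recursion at the root slot `i₀`
      have hX : (rhoX Z univ (marked Hs) : ℝ) * wprod w Hs Z =
          ∑ B : Finset ι, if j₀ ∈ B.biUnion Hs then
            (rhoT (fun i : {i // i ∈ B} => Z i.1) univ : ℝ) *
              wprod w (fun i : {i // i ∈ B} => Hs i.1) (fun i : {i // i ∈ B} => Z i.1) *
            ((rhoX (fun i : {i // i ∉ B} => Z i.1) univ (marked fun i : {i // i ∉ B} => Hs i.1) : ℝ) *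
              wprod w (fun i : {i // i ∉ B} => Hs i.1) (fun i : {i // i ∉ B} => Z i.1)) else 0 := by
        rw [rhoX_eq_sum_block Z (mem_univ i₀) hi₀m, Int.cast_sum, sum_mul, sum_filter, powerset_univ]
        refine sum_congr rfl fun B _ => ?_
        by_cases hB : i₀ ∈ B
        · rw [if_pos hB, if_pos ((mem_biUnion_iff_mem hc.1 hi₀ B).2 hB), Int.cast_mul, rhoT_restrict, rhoX_restrict_compl,
            wprod_split w B Hs Z]
          ring
        · rw [if_neg hB, if_neg (mt (mem_biUnion_iff_mem hc.1 hi₀ B).1 hB)]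
      -- inserting the derivative set `b` carried by the `B`-slots
      have hb : ∀ (B : Finset ι) (v : ℝ), (if j₀ ∈ B.biUnion Hs then v else 0) =
          ∑ b ∈ K.powerset.filter (fun b => j₀ ∈ b),
            if (OWP K Hs ∧ B.biUnion Hs = b) ∧ InQ Q Z ∧ Cov loc Hs Z then v else 0 := by
        intro B v
        have hsub : B.biUnion Hs ⊆ K := by
          rw [← hc.1.2]; exact biUnion_subset_biUnion_of_subset_left Hs (subset_univ B)
        by_cases hjB : j₀ ∈ B.biUnion Hs
        · rw [if_pos hjB]
          rw [sum_eq_single_of_mem (B.biUnion Hs) (mem_filter.2 ⟨mem_powerset.2 hsub, hjB⟩)]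
          · rw [if_pos ⟨⟨hc.1, rfl⟩, hc.2⟩]
          · intro b _ hne
            exact if_neg fun h => hne h.1.2.symm
        · rw [if_neg hjB]
          symm
          refine sum_eq_zero fun b hb' => if_neg fun h => hjB ?_
          rw [h.1.2]
          exact (mem_filter.1 hb').2
      rw [if_pos hc, hX, sum_comm]
      exact sum_congr rfl fun B _ => hb B _
    · rw [if_neg hc]
      symm
      exact sum_eq_zero fun b _ => sum_eq_zero fun B _ => if_neg fun h => hc ⟨h.1.1, h.2⟩
  unfold Draw Traw
  rw [sum_congr rfl fun Hs _ => sum_congr rfl fun Z _ => h1 Hs Z]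
  -- reorder the four sums: (Hs, Z, b, B) ↦ (b, B, Hs, Z)
  rw [sum_congr rfl fun Hs _ => sum_comm, sum_comm]
  refine sum_congr rfl fun b hb => ?_
  rw [sum_congr rfl fun Hs _ => sum_comm, sum_comm]
  refine sum_congr rfl fun B _ => ?_
  have hbK : b ⊆ K := mem_powerset.1 (mem_filter.1 hb).1
  rw [← split_core Q loc B hbK (fun Hs₁ Z₁ => (rhoT Z₁ univ : ℝ) * wprod w Hs₁ Z₁)
    (fun Hs₂ Z₂ => (rhoX Z₂ univ (marked Hs₂) : ℝ) * wprod w Hs₂ Z₂)]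

end Rooted

/-! ## §7 The ordered sums with the weights `1/m!` (clusters indexed by `Fin m`) -/

section Ord

variable [DecidableEq V] [Fintype V] [DecidableEq S] [Fintype S] (Q : Finset (Finset V)) (loc : S → V)
  (w : Finset S → Finset V → ℝ)

/-- **The un-normalized expectation, term with `m` clusters** (p. 309 last display, ordered with the weight `1/m!`: an unordered
nonoverlapping family `{X_γ} ∪ {Y_δ}` of `m` clusters is counted `m!` times). [cite: BalabanImbrieJaffe1988, p.309 (Sect. 5.14)] -/
noncomputable def Nord (m : ℕ) (K : Finset S) : ℝ := Nraw Q loc w (Fin m) K / (m.factorial : ℝ)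

/-- **Display 1 of p. 310, term with `m` clusters**: `(1/m!) ×` the rooted raw sum — the printed `Σ_{{H_γ}} Σ_{{X_γ}} Σ_{(Y₁,…,Y_B)}
(1/B!) Σ_G Π a(ℒ) Π g₃(H_γ,X_γ) Π g₃(∅,Y_δ)` re-indexed by ordered slots (a partition `{H_γ}` with `p` blocks, its clusters and an
ordered `B`-tuple give `m!/B!` labelled `m`-families, `m = p + B`, each weighted `1/m!`). [cite: BalabanImbrieJaffe1988, p.310 (Sect. 5.14)] -/
noncomputable def Dord (m : ℕ) (K : Finset S) : ℝ := Draw Q loc w (Fin m) K / (m.factorial : ℝ)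

/-- **Display 3 of p. 310, term with `m` clusters**: `(1/m!) ×` the connected raw sum (`G_c` connected).
[cite: BalabanImbrieJaffe1988, p.310 (Sect. 5.14)] -/
noncomputable def Tord (m : ℕ) (K : Finset S) : ℝ := Traw Q loc w (Fin m) K / (m.factorial : ℝ)

/-- the number of slots off `A ⊆ Fin m`. [folklore] -/
private theorem card_compl_eq {m : ℕ} (A : Finset (Fin m)) : Fintype.card {i : Fin m // i ∉ A} = m - A.card := by
  rw [Fintype.card_subtype_compl, Fintype.card_fin, Fintype.card_coe]

/-- summing a function of the two group sizes over the subsets `A ⊆ Fin m`. [folklore] -/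
private theorem sum_finset_card (m : ℕ) (f : ℕ → ℕ → ℝ) (Φ : Finset (Fin m) → ℝ) (hΦ : ∀ A, Φ A = f A.card (m - A.card)) :
    ∑ A : Finset (Fin m), Φ A = ∑ a ∈ range (m + 1), (m.choose a : ℝ) * f a (m - a) := by
  have h := Finset.sum_powerset_apply_card (fun a => f a (m - a)) (x := (univ : Finset (Fin m)))
  rw [powerset_univ, card_univ, Fintype.card_fin] at h
  rw [sum_congr rfl fun A _ => hΦ A, h]
  exact sum_congr rfl fun a _ => by rw [nsmul_eq_mul]

/-- the factorial bookkeeping `C(m,a)·(x·y)/m! = (x/a!)·(y/(m−a)!)`. [folklore] -/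
private theorem choose_mul_div_factorial {m a : ℕ} (ha : a ≤ m) (x y : ℝ) :
    (m.choose a : ℝ) * (x * y) / (m.factorial : ℝ) = x / (a.factorial : ℝ) * (y / ((m - a).factorial : ℝ)) := by
  have hfac : (m.choose a : ℝ) * a.factorial * (m - a).factorial = m.factorial := by
    exact_mod_cast Nat.choose_mul_factorial_mul_factorial ha
  have hm : (m.factorial : ℝ) ≠ 0 := by positivity
  have ha0 : (a.factorial : ℝ) ≠ 0 := by positivity
  have hc0 : ((m - a).factorial : ℝ) ≠ 0 := by positivity
  rw [div_mul_div_comm, div_eq_div_iff hm (mul_ne_zero ha0 hc0), ← hfac]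
  ring

/-- **DISPLAY 1 OF P. 310, DEGREE BY DEGREE**: the `m`-cluster term of the un-normalized expansion is the convolution of the
rooted terms with the normalization terms: `Nord m K = Σ_{a+c=m} Dord a K · Nord c ∅`. [cite: BalabanImbrieJaffe1988, p.310 (Sect. 5.14)] -/
theorem Nord_conv (m : ℕ) (K : Finset S) :
    Nord Q loc w m K = ∑ p ∈ antidiagonal m, Dord Q loc w p.1 K * Nord Q loc w p.2 ∅ := by
  have key : Nraw Q loc w (Fin m) K =
      ∑ a ∈ range (m + 1), (m.choose a : ℝ) * (Draw Q loc w (Fin a) K * Nraw Q loc w (Fin (m - a)) ∅) := by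
    rw [Nraw_eq_sum_Draw_mul]
    refine sum_finset_card m (fun a c => Draw Q loc w (Fin a) K * Nraw Q loc w (Fin c) ∅) _ fun A => ?_
    rw [← Draw_congr Q loc w A.equivFin K, ← Nraw_congr Q loc w (Fintype.equivFinOfCardEq (card_compl_eq A)) ∅]
  unfold Nord Dord
  rw [key, Finset.Nat.sum_antidiagonal_eq_sum_range_succ
    (fun a c => Draw Q loc w (Fin a) K / (a.factorial : ℝ) * (Nraw Q loc w (Fin c) ∅ / (c.factorial : ℝ))) m, sum_div]
  refine sum_congr rfl fun a ha => ?_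
  exact choose_mul_div_factorial (Nat.lt_succ_iff.1 (mem_range.1 ha)) _ _

/-- **THE ROOTED RECURSION, DEGREE BY DEGREE** (towards displays 2–3 of p. 310): for `j₀ ∈ K`,
`Dord m K = Σ_{j₀ ∈ b ⊆ K} Σ_{a+c=m} Tord a b · Dord c (K ∖ b)`. [cite: BalabanImbrieJaffe1988, p.310 (Sect. 5.14)] -/
theorem Dord_rooted (m : ℕ) (K : Finset S) {j₀ : S} (hj : j₀ ∈ K) :
    Dord Q loc w m K = ∑ b ∈ K.powerset.filter (fun b => j₀ ∈ b), ∑ p ∈ antidiagonal m,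
      Tord Q loc w p.1 b * Dord Q loc w p.2 (K \ b) := by
  have key : Draw Q loc w (Fin m) K = ∑ b ∈ K.powerset.filter (fun b => j₀ ∈ b),
      ∑ a ∈ range (m + 1), (m.choose a : ℝ) * (Traw Q loc w (Fin a) b * Draw Q loc w (Fin (m - a)) (K \ b)) := by
    rw [Draw_eq_sum_Traw_mul Q loc w K hj]
    refine sum_congr rfl fun b _ => ?_
    refine sum_finset_card m (fun a c => Traw Q loc w (Fin a) b * Draw Q loc w (Fin c) (K \ b)) _ fun A => ?_
    rw [← Traw_congr Q loc w A.equivFin b, ← Draw_congr Q loc w (Fintype.equivFinOfCardEq (card_compl_eq A)) (K \ b)]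
  unfold Dord Tord
  rw [key, sum_div]
  refine sum_congr rfl fun b _ => ?_
  rw [Finset.Nat.sum_antidiagonal_eq_sum_range_succ
    (fun a c => Traw Q loc w (Fin a) b / (a.factorial : ℝ) * (Draw Q loc w (Fin c) (K \ b) / (c.factorial : ℝ))) m, sum_div]
  refine sum_congr rfl fun a ha => ?_
  exact choose_mul_div_factorial (Nat.lt_succ_iff.1 (mem_range.1 ha)) _ _

omit [DecidableEq V] [Fintype V] [Fintype S] in
/-- `OWP ∅` means: no derivative anywhere. [cite: BalabanImbrieJaffe1988, p.310 (Sect. 5.14)] -/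
theorem owp_empty_iff {ι : Type*} [Fintype ι] (Hs : ι → Finset S) : OWP ∅ Hs ↔ ∀ i, Hs i = ∅ := by
  constructor
  · intro h i
    exact subset_empty.1 (h.2 ▸ subset_biUnion_of_mem Hs (mem_univ i))
  · intro h
    refine ⟨fun i i' _ => by rw [h i]; exact disjoint_empty_left _, ?_⟩
    rw [eq_empty_iff_forall_notMem]
    intro j hj
    obtain ⟨i, -, hi⟩ := mem_biUnion.1 hj
    rw [h i] at hi
    exact notMem_empty j hi

/-- The rooted term with no derivatives: only the empty family (`m = 0`) survives — `Dord m ∅ = 𝟙[m = 0]`.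
[cite: BalabanImbrieJaffe1988, p.310 (Sect. 5.14)] -/
theorem Dord_empty (m : ℕ) : Dord Q loc w m ∅ = if m = 0 then 1 else 0 := by
  unfold Dord Draw
  rcases Nat.eq_zero_or_pos m with rfl | hm
  · rw [if_pos rfl, Nat.factorial_zero, Nat.cast_one, div_one, Fintype.sum_unique, Fintype.sum_unique, if_pos]
    · rw [Finset.univ_eq_empty, rhoX_empty, Int.cast_one, one_mul]
      unfold wprod
      rw [Finset.univ_eq_empty, prod_empty]
    · refine ⟨(owp_empty_iff _).2 fun i => i.elim0, fun i => i.elim0, fun i => i.elim0⟩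
  · rw [if_neg (Nat.pos_iff_ne_zero.1 hm)]
    rw [sum_eq_zero fun Hs _ => sum_eq_zero fun Z _ => ?_, zero_div]
    split_ifs with hc
    · have hmk : marked Hs = ∅ := by
        refine filter_eq_empty_iff.2 fun i _ => ?_
        rw [(owp_empty_iff Hs).1 hc.1 i]
        exact not_nonempty_empty
      rw [hmk, rhoX_root_empty Z (inter_empty _), if_neg, Int.cast_zero, zero_mul]
      rw [Finset.univ_eq_empty_iff]
      exact not_isEmpty_of_nonempty (Fin m) (h := ⟨⟨0, hm⟩⟩)
    · rfl

/-- The connected term needs at least one cluster: `Tord 0 K = 0` for `K ≠ ∅`. [cite: BalabanImbrieJaffe1988, p.310 (Sect. 5.14)] -/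
theorem Tord_zero {K : Finset S} (hK : K.Nonempty) : Tord Q loc w 0 K = 0 := by
  unfold Tord Traw
  rw [Fintype.sum_unique, Fintype.sum_unique, if_neg, zero_div]
  rintro ⟨⟨-, hu⟩, -⟩
  rw [Finset.univ_eq_empty, biUnion_empty] at hu
  exact hK.ne_empty hu.symm

/-- The empty family is the only one with no clusters: `Nord 0 K = 𝟙[K = ∅]`. [cite: BalabanImbrieJaffe1988, p.309 (Sect. 5.14)] -/
theorem Nord_zero (K : Finset S) : Nord Q loc w 0 K = if K = ∅ then 1 else 0 := by
  unfold Nord Nraw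
  rw [Nat.factorial_zero, Nat.cast_one, div_one, Fintype.sum_unique, Fintype.sum_unique]
  by_cases hK : K = ∅
  · subst hK
    rw [if_pos, if_pos rfl, Finset.univ_eq_empty, hardCore_empty, Int.cast_one, one_mul]
    · unfold wprod; rw [Finset.univ_eq_empty, prod_empty]
    · exact ⟨(owp_empty_iff _).2 fun i => i.elim0, fun i => i.elim0, fun i => i.elim0⟩
  · rw [if_neg, if_neg hK]
    rintro ⟨⟨-, hu⟩, -⟩
    rw [Finset.univ_eq_empty, biUnion_empty] at hu
    exact hK hu.symm

/-- With nonempty polymers, pairwise disjoint clusters are distinct polymers: no hard-core family has more than `|Q|` clusters, so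
`Nord m ∅ = 0` for `m > |Q|` (the normalization is a finite sum). [cite: BalabanImbrieJaffe1988, p.310 (Sect. 5.14)] -/
theorem Nord_empty_eq_zero (hQ : ∅ ∉ Q) {m : ℕ} (hm : Q.card < m) : Nord Q loc w m ∅ = 0 := by
  unfold Nord Nraw
  rw [sum_eq_zero fun Hs _ => sum_eq_zero fun Z _ => ?_, zero_div]
  split_ifs with hc
  · have hZ := hc.2.1
    have h0 : hardCore Z (univ : Finset (Fin m)) = 0 := by
      unfold hardCore
      rw [if_neg]
      intro hpd
      have hinj : Function.Injective fun i : Fin m => (⟨Z i, hZ i⟩ : {Y // Y ∈ Q}) := by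
        intro i i' h
        by_contra hne
        have hd := hpd i (mem_univ _) i' (mem_univ _) hne
        have heq : Z i = Z i' := congrArg Subtype.val h
        rw [heq, disjoint_self, Finset.bot_eq_empty] at hd
        exact hQ (hd ▸ hZ i')
      have hle := Fintype.card_le_of_injective _ hinj
      rw [Fintype.card_fin, Fintype.card_coe] at hle
      exact absurd hle (not_le.2 hm)
    rw [h0, Int.cast_zero, zero_mul]
  · rfl

/-! ## §8 The series over the number of clusters: displays 1, 2, 3 of p. 310 -/

/-- **`N(K) = Σ_m Nord m K`** — the un-normalized expectation `⟨Π_{j∈K}(d/dt)_{γ_j} χ′ e^{−tṼ}⟩_{1,Λ₁₂}` expanded as on p. 309 (last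
display); `N(∅) = z_t(Λ₁₂)` is the normalization. [cite: BalabanImbrieJaffe1988, p.309 (Sect. 5.14)] -/
noncomputable def Nsum (K : Finset S) : ℝ := ∑' m, Nord Q loc w m K

/-- **the right side of display 1 of p. 310** summed over the number of clusters. [cite: BalabanImbrieJaffe1988, p.310 (Sect. 5.14)] -/
noncomputable def Dsum (K : Finset S) : ℝ := ∑' m, Dord Q loc w m K

/-- **the right side of display 3 of p. 310** (connected graphs `G_c`) summed over the number of clusters.
[cite: BalabanImbrieJaffe1988, p.310 (Sect. 5.14)] -/
noncomputable def Tsum (K : Finset S) : ℝ := ∑' m, Tord Q loc w m K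

/-- the normalization series has finite support. [cite: BalabanImbrieJaffe1988, p.310 (Sect. 5.14)] -/
theorem summable_norm_Nord_empty (hQ : ∅ ∉ Q) : Summable fun m => ‖Nord Q loc w m ∅‖ := by
  refine summable_of_ne_finset_zero (s := range (Q.card + 1)) fun m hm => ?_
  rw [mem_range, not_lt] at hm
  rw [Nord_empty_eq_zero Q loc w hQ (Nat.lt_of_succ_le hm), norm_zero]

/-- **DISPLAY 1 OF P. 310** (*"This enables us to factor out the normalization z_t(Λ₁₂^{(k)}) to obtain ⟨Π_{j∈H}(d/dt)_{γ_j}⟩_t =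
Σ_{{H_γ}∈𝒫(H)} Σ_{{X_γ}} Σ_{(Y₁,…,Y_B)} (1/B!) Σ_G Π_{ℒ∈G} a(ℒ) Π_γ g₃(H_γ,X_γ) Π_{δ=1}^B g₃(∅,Y_δ)"*): the un-normalized
expansion equals the normalization `N(∅) = z_t` times the rooted series, `N(K) = N(∅) · D(K)`, whenever the rooted series converges
absolutely (polymers nonempty). Dividing by `z_t ≠ 0` gives the display as printed (`moment_eq_Dsum`).
[cite: BalabanImbrieJaffe1988, p.310 (Sect. 5.14)] -/
theorem Nsum_eq_mul_Dsum (hQ : ∅ ∉ Q) (K : Finset S) (hD : Summable fun m => ‖Dord Q loc w m K‖) :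
    Nsum Q loc w K = Nsum Q loc w ∅ * Dsum Q loc w K := by
  unfold Nsum Dsum
  rw [mul_comm, tsum_mul_tsum_eq_tsum_sum_antidiagonal_of_summable_norm hD (summable_norm_Nord_empty Q loc w hQ)]
  exact tsum_congr fun m => Nord_conv Q loc w m K

/-- display 1 as printed: the NORMALIZED expectation `⟨Π_{j∈K}(d/dt)_{γ_j}⟩_t := N(K)/z_t` equals the rooted series.
[cite: BalabanImbrieJaffe1988, p.310 (Sect. 5.14)] -/
theorem moment_eq_Dsum (hQ : ∅ ∉ Q) (hz : Nsum Q loc w ∅ ≠ 0) (K : Finset S)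
    (hD : Summable fun m => ‖Dord Q loc w m K‖) : Nsum Q loc w K / Nsum Q loc w ∅ = Dsum Q loc w K := by
  rw [Nsum_eq_mul_Dsum Q loc w hQ K hD, mul_div_cancel_left₀ _ hz]

/-- absolute convergence of the rooted series from that of the connected series of the sub-collections (by the rooted recursion).
[cite: BalabanImbrieJaffe1988, p.310 (Sect. 5.14)] -/
theorem summable_norm_Dord (K : Finset S) (hT : ∀ b ⊆ K, b.Nonempty → Summable fun m => ‖Tord Q loc w m b‖) :
    Summable fun m => ‖Dord Q loc w m K‖ := by
  induction K using Finset.strongInduction with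
  | H K ih =>
    rcases K.eq_empty_or_nonempty with rfl | ⟨j₀, hj⟩
    · refine summable_of_ne_finset_zero (s := {0}) fun m hm => ?_
      rw [Dord_empty, if_neg (by simpa using hm), norm_zero]
    · have hbd : ∀ m, ‖Dord Q loc w m K‖ ≤ ∑ b ∈ K.powerset.filter (fun b => j₀ ∈ b),
          ∑ p ∈ antidiagonal m, ‖Tord Q loc w p.1 b‖ * ‖Dord Q loc w p.2 (K \ b)‖ := fun m => by
        rw [Dord_rooted Q loc w m K hj]
        refine (norm_sum_le _ _).trans (sum_le_sum fun b _ => (norm_sum_le _ _).trans (sum_le_sum fun p _ => ?_))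
        exact norm_mul_le _ _
      refine Summable.of_nonneg_of_le (fun m => norm_nonneg _) hbd (summable_sum fun b hb => ?_)
      obtain ⟨hbK, hjb⟩ := mem_filter.1 hb
      rw [mem_powerset] at hbK
      have hTb := hT b hbK ⟨j₀, hjb⟩
      have hDb := ih (K \ b) (sdiff_ssubset hbK ⟨j₀, hjb⟩) fun b' hb' hne => hT b' (hb'.trans sdiff_subset) hne
      exact summable_sum_mul_antidiagonal_of_summable_mul (f := fun m => ‖Tord Q loc w m b‖)
        (g := fun m => ‖Dord Q loc w m (K \ b)‖)
        (Summable.mul_of_nonneg hTb hDb (fun _ => norm_nonneg _) fun _ => norm_nonneg _)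

/-- the rooted recursion, summed: `D(K) = Σ_{j₀∈b⊆K} T(b) · D(K ∖ b)` (Cauchy products of absolutely convergent series).
[cite: BalabanImbrieJaffe1988, p.310 (Sect. 5.14)] -/
theorem Dsum_rooted (K : Finset S) {j₀ : S} (hj : j₀ ∈ K)
    (hT : ∀ b ⊆ K, b.Nonempty → Summable fun m => ‖Tord Q loc w m b‖) :
    Dsum Q loc w K = ∑ b ∈ K.powerset.filter (fun b => j₀ ∈ b), Tsum Q loc w b * Dsum Q loc w (K \ b) := by
  have hsum : ∀ b ∈ K.powerset.filter (fun b => j₀ ∈ b), (Summable fun m => ‖Tord Q loc w m b‖) ∧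
      Summable fun m => ‖Dord Q loc w m (K \ b)‖ := fun b hb => by
    obtain ⟨hbK, hjb⟩ := mem_filter.1 hb
    rw [mem_powerset] at hbK
    exact ⟨hT b hbK ⟨j₀, hjb⟩, summable_norm_Dord Q loc w (K \ b) fun b' hb' hne => hT b' (hb'.trans sdiff_subset) hne⟩
  have h1 : ∀ m, Dord Q loc w m K = ∑ b ∈ K.powerset.filter (fun b => j₀ ∈ b),
      ∑ p ∈ antidiagonal m, Tord Q loc w p.1 b * Dord Q loc w p.2 (K \ b) := fun m => Dord_rooted Q loc w m K hj
  have h2 : ∀ b ∈ K.powerset.filter (fun b => j₀ ∈ b),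
      Summable fun m => ∑ p ∈ antidiagonal m, Tord Q loc w p.1 b * Dord Q loc w p.2 (K \ b) := fun b hb => by
    obtain ⟨hTb, hDb⟩ := hsum b hb
    exact summable_sum_mul_antidiagonal_of_summable_mul (f := fun m => Tord Q loc w m b)
      (g := fun m => Dord Q loc w m (K \ b))
      (summable_mul_of_summable_norm (f := fun m => Tord Q loc w m b) (g := fun m => Dord Q loc w m (K \ b)) hTb hDb)
  have h3 : ∀ b ∈ K.powerset.filter (fun b => j₀ ∈ b),
      ∑' m, ∑ p ∈ antidiagonal m, Tord Q loc w p.1 b * Dord Q loc w p.2 (K \ b) = Tsum Q loc w b * Dsum Q loc w (K \ b) :=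
    fun b hb => by
    obtain ⟨hTb, hDb⟩ := hsum b hb
    unfold Tsum Dsum
    exact (tsum_mul_tsum_eq_tsum_sum_antidiagonal_of_summable_norm hTb hDb).symm
  unfold Dsum
  rw [tsum_congr h1, Summable.tsum_finsetSum h2]
  exact sum_congr rfl h3

/-- **DISPLAY 2 OF P. 310 FOR THE CONNECTED SERIES** (*"The connected components of G define a partition of H which corresponds to
the partition in the formula ⟨Π_{j∈H}(d/dt)_{γ_j}⟩_t = Σ_{{H′_τ}∈𝒫(H)} Π_τ ⟨Π_{j∈H′_τ}[;(d/dt)_{γ_j}]⟩_t"*): the rooted series is the sum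
over the set partitions of `K` of the products of the connected series of the blocks, `D(K) = Σ_{π∈𝒫(K)} Π_{b∈π} T(b)`.
[cite: BalabanImbrieJaffe1988, p.310 (Sect. 5.14)] -/
theorem Dsum_eq_sum_setPartitions (K : Finset S) (hT : ∀ b ⊆ K, b.Nonempty → Summable fun m => ‖Tord Q loc w m b‖) :
    Dsum Q loc w K = ∑ π ∈ setPartitions K, ∏ b ∈ π, Tsum Q loc w b := by
  induction K using Finset.strongInduction with
  | H K ih =>
    rcases K.eq_empty_or_nonempty with rfl | ⟨j₀, hj⟩
    · rw [setPartitions_empty, sum_singleton, prod_empty]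
      unfold Dsum
      rw [tsum_eq_single 0 fun m hm => by rw [Dord_empty, if_neg hm], Dord_empty, if_pos rfl]
    · rw [Dsum_rooted Q loc w K hj hT, sum_setPartitions_eq_sum_block hj]
      refine sum_congr rfl fun b hb => ?_
      obtain ⟨hbK, hjb⟩ := mem_filter.1 hb
      rw [mem_powerset] at hbK
      rw [ih (K \ b) (sdiff_ssubset hbK ⟨j₀, hjb⟩) fun b' hb' hne => hT b' (hb'.trans sdiff_subset) hne, mul_sum]
      refine sum_congr rfl fun κ hκ => ?_
      rw [prod_insert ((mem_setPartitions.1 hκ).notMem_of_sdiff ⟨j₀, hjb⟩)]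

/-- **DISPLAY 3 OF P. 310** (*"Thus we have a formula ⟨Π_{j∈H}[;(d/dt)_{γ_j}]⟩_t = Σ_{{H_γ}∈𝒫(H)} Σ_{{X_γ}} Σ_{(Y₁,…,Y_B)} (1/B!)
Σ_{G_c} Π_{ℒ∈G_c} a(ℒ) Π_γ g₃(H_γ,X_γ) Π_{δ=1}^B g₃(∅,Y_δ), where G_c runs over connected graphs involving all clusters"*): ANY
family of truncated functions `κ` satisfying display 2 with the rooted series (the normalized expectations, by display 1) on all
nonempty sub-collections of `H` IS the connected series: `κ(K) = T(K)` for all nonempty `K ⊆ H` — display 2 determines the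
truncated functions by Möbius inversion over set partitions. [cite: BalabanImbrieJaffe1988, p.310 (Sect. 5.14)] -/
theorem truncated_eq_Tsum (H : Finset S) (hT : ∀ b ⊆ H, b.Nonempty → Summable fun m => ‖Tord Q loc w m b‖)
    (κ : Finset S → ℝ) (hκ : ∀ K ⊆ H, K.Nonempty → Dsum Q loc w K = ∑ π ∈ setPartitions K, ∏ b ∈ π, κ b) :
    ∀ K ⊆ H, K.Nonempty → κ K = Tsum Q loc w K := by
  intro K
  induction K using Finset.strongInduction with
  | H K ih =>
    intro hKH hK
    have h1 := hκ K hKH hK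
    rw [Dsum_eq_sum_setPartitions Q loc w K fun b hb hne => hT b (hb.trans hKH) hne] at h1
    have hmem : {K} ∈ setPartitions K := mem_setPartitions.2 (isSetPartition_singleton hK)
    rw [← add_sum_erase _ _ hmem, ← add_sum_erase _ _ hmem, prod_singleton, prod_singleton] at h1
    have hrest : ∑ π ∈ (setPartitions K).erase {K}, ∏ b ∈ π, κ b = ∑ π ∈ (setPartitions K).erase {K}, ∏ b ∈ π, Tsum Q loc w b := by
      refine sum_congr rfl fun π hπ => prod_congr rfl fun b hb => ?_
      obtain ⟨hne, hπ'⟩ := mem_erase.1 hπ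
      have hπs := mem_setPartitions.1 hπ'
      exact ih b (hπs.ssubset_of_ne_singleton hne hb) ((hπs.subset hb).trans hKH) (hπs.nonempty_of_mem hb)
    linarith

/-- **DISPLAYS 1–3 TOGETHER, AS PRINTED.** Polymers nonempty, normalization `z_t = N(∅) ≠ 0`, the connected series of every nonempty
`K ⊆ H` absolutely convergent. If the truncated functions `⟨Π_{j∈K}[;(d/dt)_{γ_j}]⟩_t =: κ(K)` are related to the normalized
expectations `⟨Π_{j∈K}(d/dt)_{γ_j}⟩_t = N(K)/z_t` by display 2 for every nonempty `K ⊆ H`, then `κ(H)` equals the connected-graph series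
`T(H)` of display 3. [cite: BalabanImbrieJaffe1988, p.310 (Sect. 5.14)] -/
theorem display3 (H : Finset S) (hH : H.Nonempty) (hQ : ∅ ∉ Q) (hz : Nsum Q loc w ∅ ≠ 0)
    (hT : ∀ b ⊆ H, b.Nonempty → Summable fun m => ‖Tord Q loc w m b‖) (κ : Finset S → ℝ)
    (hκ : ∀ K ⊆ H, K.Nonempty → Nsum Q loc w K / Nsum Q loc w ∅ = ∑ π ∈ setPartitions K, ∏ b ∈ π, κ b) :
    κ H = Tsum Q loc w H := by
  refine truncated_eq_Tsum Q loc w H hT κ (fun K hKH hK => ?_) H (Subset.refl H) hH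
  rw [← hκ K hKH hK, moment_eq_Dsum Q loc w hQ hz K]
  exact summable_norm_Dord Q loc w K fun b hb hne => hT b (hb.trans hKH) hne

end Ord

end Literature.MathematicalPhysics.QuantumFieldTheory.BalabanImbrieJaffe1984to88.BIJ88ConnectedGraphResummation

end
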